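import Literature.Topology.FourManifolds.CollarTheorem
import Literature.Topology.FourManifolds.MorseTurnAbout

/-!
# The level function of a sector — helpers for stub `stub_sectorCores` of line
`lp-by-sphere-system-surgery` (crux `AgkCor6Sufficiency`, item stmt-SmoothPoincare4-10894, routes
CongruenceShadows / GroupTrisection; lead reshape r4, Step A)

For a compact smooth `4`-manifold with boundary `W` presented by a Morse function `φ` adapted to
`∂W` (`IsMorseAdapted`), and a profile `β : ℝ → ℝ` (downstream: the skeleton's `coreProfile`, whose
calculus is in `…StubSectorCoresHelpers.lean`; here only its properties are assumed), the
registered helper stub `stub_sectorLevelData : SectorLevelData` provides a collar `c` of `∂W`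
**adapted to `φ`** and the **sector level function** `F = β ∘ t` of its collar coordinate `t`,
continued by `1`:

* `exists_flowoutInput_of_isMorseAdapted` — Milnor's flow-out input (`BoundaryFlowout.lean`) with
  boundary-defining function `1 - φ`, regular on `{1 - φ ≤ δ}`; the flow-out collar
  (`CollarCriterion.lean`, `OpenCollarData.toCollar`) then has collar coordinate
  `t = (2/a)(1 - φ)` (`height_toCollar`, `exists_toCollar_eq_of_height_le`);
* `sectorFun β D a = β ((2/a)(1 - φ))`: smooth, `= β t` on the collar, `0` on `∂W` and wherever
  `φ > 1 - a/8`, `≥ 1/2` exactly on the core `{φ ≤ 1 - a/4}`, and **regular along its level `1/2`**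
  (chain rule `isMCriticalPt_of_comp`: there `1 - φ = a/4 ≤ δ` and `β' (1/2) ≠ 0`).

## References

* J. Milnor, *Lectures on the h-cobordism theorem* (1965), proof of Thm. 3.4. [MilnorHCobordism1965]
* A. Abrams, D. Gay, R. Kirby, *Group trisections and smooth 4-manifolds*, Geom. Topol. 22
  (2018), proof of Thm. 5. [AbramsGayKirby2018]
-/

noncomputable section

-- the prescribed namespace `Summit.<P>.<Sub>.…` duplicates `SmoothPoincare4` (P = Sub)
set_option linter.dupNamespace false

open Set Function
open scoped Manifold ContDiff Topology

namespace Summit.SmoothPoincare4.SmoothPoincare4.Cruxes.AgkCor6Sufficiency.LpBySphereSystemSurgery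

open Literature.Topology.FourManifolds

universe u

/-! ## 1. Chain rule for critical points -/

section ChainRule

variable {E H : Type*} [NormedAddCommGroup E] [NormedSpace ℝ E] [TopologicalSpace H]
  {I : ModelWithCorners ℝ E H} {M : Type u} [TopologicalSpace M] [ChartedSpace H M]

/-- **Chain rule for critical points**: if `g' (φ w) ≠ 0`, a critical point of `g ∘ φ` is a
critical point of `φ`. [folklore] -/
theorem isMCriticalPt_of_comp {φ : M → ℝ} {w : M} (hφ : MDifferentiableAt I 𝓘(ℝ, ℝ) φ w)
    {g : ℝ → ℝ} {d : ℝ} (hg : HasDerivAt g d (φ w)) (hd : d ≠ 0)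
    (h : IsMCriticalPt I (g ∘ φ) w) : IsMCriticalPt I φ w := by
  have hg' : HasMFDerivAt 𝓘(ℝ, ℝ) 𝓘(ℝ, ℝ) g (φ w)
      (ContinuousLinearMap.smulRight (1 : ℝ →L[ℝ] ℝ) d) :=
    hg.hasFDerivAt.hasMFDerivAt
  have hc := hg'.comp w hφ.hasMFDerivAt
  unfold IsMCriticalPt at h ⊢
  rw [hc.mfderiv] at h
  ext v
  have key : mlineDeriv I φ w v * d = 0 := by
    have := ContinuousLinearMap.ext_iff.1 h v
    change mlineDeriv I φ w v • d = (0 : ℝ) at this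
    rwa [smul_eq_mul] at this
  have h0 : mlineDeriv I φ w v = 0 := (mul_eq_zero.1 key).resolve_right hd
  exact h0

end ChainRule

/-! ## 2. Flow-out collars adapted to a Morse function -/

section Flowout

variable {n : ℕ} {M : Type u} [TopologicalSpace M] [T2Space M] [CompactSpace M]
  [ChartedSpace (EuclideanHalfSpace (n + 2)) M] [IsManifold (𝓡∂ (n + 2)) ∞ M]

/-- **Flow-out input from a Morse function adapted to the boundary** (Milnor 1965, proof of
Thm. 3.4, with the boundary-defining function `1 - φ`): `f = 1 - φ ≥ 0` vanishes exactly on `∂M`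
and is regular there, hence on some `{f ≤ δ}`, where a field `ξ` with `ξ(f) = 1` exists
(`exists_contMDiffSection_mlineDeriv_eq_one_on`); moreover `φ` has no critical point in
`{f ≤ δ}`. [cite: MilnorHCobordism1965, proof of Thm. 3.4] -/
theorem exists_flowoutInput_of_isMorseAdapted {φ : M → ℝ} (hφ : IsMorseAdapted (𝓡∂ (n + 2)) φ) :
    ∃ D : FlowoutInput (n + 1) M, (∀ z, D.f z = 1 - φ z) ∧
      ∀ z, D.f z ≤ D.δ → ¬ IsMCriticalPt (𝓡∂ (n + 2)) φ z := by
  classical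
  have hf₁ : ContMDiff (𝓡∂ (n + 2)) 𝓘(ℝ, ℝ) ∞ φ := hφ.1.1
  set f : M → ℝ := fun z => 1 - φ z with hf
  have hfs : ContMDiff (𝓡∂ (n + 2)) 𝓘(ℝ, ℝ) ∞ f :=
    ((contDiff_const (c := (1 : ℝ))).sub contDiff_id).contMDiff.comp hf₁
  have hfb : ∀ z, f z = 0 ↔ z ∈ (𝓡∂ (n + 2)).boundary M := by
    intro z
    constructor
    · intro hz
      by_contra hzb
      have hzi : (𝓡∂ (n + 2)).IsInteriorPoint z :=
        ((𝓡∂ (n + 2)).isInteriorPoint_or_isBoundaryPoint z).resolve_right hzb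
      have h := hφ.2.2 z hzi
      simp only [hf] at hz
      linarith
    · intro hz
      simp only [hf, (hφ.2.1 z hz).1, sub_self]
  have hf0 : ∀ z, 0 ≤ f z := by
    intro z
    rcases (𝓡∂ (n + 2)).isInteriorPoint_or_isBoundaryPoint z with hzi | hzb
    · have h := hφ.2.2 z hzi
      simp only [hf]; linarith
    · simp only [hf, (hφ.2.1 z hzb).1, sub_self, le_refl]
  have hcrit : ∀ z, IsMCriticalPt (𝓡∂ (n + 2)) f z ↔ IsMCriticalPt (𝓡∂ (n + 2)) φ z := fun z =>
    isMCriticalPt_const_sub_iff 1 (hf₁.mdifferentiableAt (by simp))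
  have hreg : ∀ z, f z = 0 → mfderiv (𝓡∂ (n + 2)) 𝓘(ℝ, ℝ) f z ≠ 0 := by
    intro z hz hc
    exact (hφ.2.1 z ((hfb z).1 hz)).2 ((hcrit z).1 hc)
  obtain ⟨δ', hδ', hδ'reg⟩ := exists_pos_forall_mfderiv_ne_zero hfs hf0 hreg
  set δ := δ' / 2 with hδ
  have hδpos : 0 < δ := by positivity
  have hreg2 : ∀ z ∈ {z : M | f z ≤ δ}, mfderiv (𝓡∂ (n + 2)) 𝓘(ℝ, ℝ) f z ≠ 0 := fun z hz =>
    hδ'reg z (by simp only [mem_setOf_eq] at hz; linarith)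
  obtain ⟨ξ, hξ⟩ := exists_contMDiffSection_mlineDeriv_eq_one_on hfs
    (isClosed_le hfs.continuous continuous_const) hreg2
  refine ⟨⟨f, ξ, δ, hδpos, hfs, hf0, hfb, ξ.contMDiff, fun z hz => hξ z hz⟩, fun z => rfl,
    fun z hz hc => ?_⟩
  exact hreg2 z hz ((hcrit z).2 hc)

omit [T2Space M] [CompactSpace M] in
/-- **Shrinking the height of a flow-out cover below `δ`** (the `cover` and `a_le` clauses are
monotone in the height). [folklore] -/
theorem exists_cover_a_le (D : FlowoutInput (n + 1) M) (Γ : D.Cover) :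
    ∃ Γ' : D.Cover, Γ'.a ≤ D.δ :=
  ⟨{ T := Γ.T
     f_lt := Γ.f_lt
     a := min Γ.a D.δ
     a_pos := lt_min Γ.a_pos D.δ_pos
     a_le := fun y hy => (min_le_left _ _).trans (Γ.a_le y hy)
     cover := fun z hz => Γ.cover z (hz.trans (min_le_left _ _)) }, min_le_right _ _⟩

end Flowout

section CollarFacts

variable {n : ℕ} {M : Type u} [TopologicalSpace M] [T2Space M]
  [ChartedSpace (EuclideanHalfSpace (n + 2)) M] [IsManifold (𝓡∂ (n + 2)) ∞ M]
  (b : BoundaryData (𝓡∂ (n + 2)) M (𝓡 (n + 1))) [Nonempty b.carrier]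
  {D : FlowoutInput (n + 1) M} (Γ : D.Cover)

/-- The height of the flow-out collar data is `2 f / a` (definitional).
[cite: MilnorHCobordism1965, proof of Thm. 3.4] -/
theorem openCollarData_height (z : M) : (Γ.openCollarData b).height z = D.f z * (2 / Γ.a) := rfl

/-- The collar coordinate of the flow-out collar is its height: `height (c (x, t)) = t`.
[cite: MilnorHCobordism1965, proof of Thm. 3.4] -/
theorem height_toCollar (x : b.carrier) (t : Set.Icc (0 : ℝ) 1) :
    (Γ.openCollarData b).height ((Γ.openCollarData b).toCollar (x, t)) = t :=
  (Γ.openCollarData b).height_apply x t ⟨t.2.1, t.2.2.trans_lt one_lt_two⟩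

/-- **A point of height `≤ 1` lies in the closed flow-out collar**, at its height.
[cite: MilnorHCobordism1965, proof of Thm. 3.4] -/
theorem exists_toCollar_eq_of_height_le {z : M} (hz : (Γ.openCollarData b).height z ≤ 1) :
    ∃ (x : b.carrier) (t : Set.Icc (0 : ℝ) 1), (t : ℝ) = (Γ.openCollarData b).height z ∧
      (Γ.openCollarData b).toCollar (x, t) = z := by
  set OC := Γ.openCollarData b
  have ha := Γ.a_pos
  have hreg : z ∈ OC.region := by
    show D.f z < Γ.a
    rw [openCollarData_height] at hz
    have h2 : D.f z * 2 ≤ Γ.a := by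
      have := mul_le_mul_of_nonneg_right hz ha.le
      rwa [one_mul, mul_assoc, div_mul_cancel₀ _ ha.ne'] at this
    linarith [D.f_nonneg z]
  have hmem := OC.height_mem z hreg
  exact ⟨OC.proj z, ⟨OC.height z, hmem.1, hz⟩, rfl, OC.apply_proj_height z hreg⟩

end CollarFacts

/-! ## 3. The level function of a sector -/

section SectorFun

variable {β : ℝ → ℝ} {W : Type u} [TopologicalSpace W] [ChartedSpace (EuclideanHalfSpace 4) W]
  [IsManifold (𝓡∂ 4) ∞ W]

/-- The **sector level function** `F = β (2 f / a)` of a profile `β`, flow-out input `D` (with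
boundary-defining function `f = 1 - φ`) and height `a`: the profile of the collar coordinate,
continued by `1`. [folklore] -/
def sectorFun (β : ℝ → ℝ) (D : FlowoutInput 3 W) (a : ℝ) (w : W) : ℝ := β (D.f w * (2 / a))

variable (β) (D : FlowoutInput 3 W) {a : ℝ} (ha : 0 < a) {φ : W → ℝ} (hDf : ∀ w, D.f w = 1 - φ w)
  (hβ₁ : ∀ s : ℝ, s ≤ 1 / 4 → β s = 0) (hβ₂ : ∀ s : ℝ, β s ≤ 1 / 2 ↔ s ≤ 1 / 2)
  (hβ₃ : ∀ s : ℝ, 1 / 2 ≤ β s ↔ 1 / 2 ≤ s)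

/-- The sector level function of a smooth profile is smooth. [folklore] -/
theorem contMDiff_sectorFun (hβ : ContDiff ℝ ∞ β) (a : ℝ) :
    ContMDiff (𝓡∂ 4) 𝓘(ℝ, ℝ) ∞ (sectorFun β D a) :=
  (hβ.comp (contDiff_id.mul contDiff_const)).comp_contMDiff D.f_smooth

include hβ₁ in
/-- The sector level function vanishes on the boundary (collar coordinate `0`). [folklore] -/
theorem sectorFun_eq_zero_of_mem_boundary (a : ℝ) {w : W} (hw : w ∈ (𝓡∂ 4).boundary W) :
    sectorFun β D a w = 0 := by
  unfold sectorFun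
  rw [(D.f_eq_zero_iff w).2 hw, zero_mul]
  exact hβ₁ _ (by norm_num)

include ha hDf

include hβ₃ in
/-- `F ≥ 1/2` exactly on the core `{φ ≤ 1 - a/4}` (collar coordinate `≥ 1/2`). [folklore] -/
theorem half_le_sectorFun_iff {w : W} : 1 / 2 ≤ sectorFun β D a w ↔ φ w ≤ 1 - a / 4 := by
  unfold sectorFun
  rw [hβ₃, hDf, show (1 - φ w) * (2 / a) = (1 - φ w) * 2 / a by ring, le_div_iff₀ ha]
  constructor <;> intro h <;> linarith

include hβ₂ in
/-- `F ≤ 1/2` exactly on the prism part `{1 - a/4 ≤ φ}` (collar coordinate `≤ 1/2`). [folklore] -/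
theorem sectorFun_le_half_iff {w : W} : sectorFun β D a w ≤ 1 / 2 ↔ 1 - a / 4 ≤ φ w := by
  unfold sectorFun
  rw [hβ₂, hDf, show (1 - φ w) * (2 / a) = (1 - φ w) * 2 / a by ring, div_le_iff₀ ha]
  constructor <;> intro h <;> linarith

include hβ₂ hβ₃ in
/-- `F = 1/2` exactly on `{φ = 1 - a/4}` (collar coordinate `1/2`). [folklore] -/
theorem sectorFun_eq_half_iff {w : W} : sectorFun β D a w = 1 / 2 ↔ φ w = 1 - a / 4 := by
  rw [le_antisymm_iff, le_antisymm_iff, sectorFun_le_half_iff β D ha hDf hβ₂,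
    half_le_sectorFun_iff β D ha hDf hβ₃]
  exact and_comm

include hβ₁ in
/-- Near the boundary (`φ > 1 - a/8`, i.e. collar coordinate `< 1/4`) the sector function
vanishes. [folklore] -/
theorem sectorFun_eq_zero_of_lt {w : W} (h : 1 - a / 8 < φ w) : sectorFun β D a w = 0 := by
  unfold sectorFun
  apply hβ₁
  rw [hDf, show (1 - φ w) * (2 / a) = (1 - φ w) * 2 / a by ring, div_le_iff₀ ha]
  linarith

include hβ₂ hβ₃ in
/-- **The sector function is regular along its level `1/2`** (chain rule: there
`f = 1 - φ = a/4`, where `φ` is regular by hypothesis, and `β' (1/2) ≠ 0`). [folklore] -/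
theorem not_isMCriticalPt_sectorFun (hβ₄ : ∃ d : ℝ, d ≠ 0 ∧ HasDerivAt β d (1 / 2))
    (hφs : ContMDiff (𝓡∂ 4) 𝓘(ℝ, ℝ) ∞ φ) {w : W}
    (hw : sectorFun β D a w = 1 / 2) (hreg : ¬ IsMCriticalPt (𝓡∂ 4) φ w) :
    ¬ IsMCriticalPt (𝓡∂ 4) (sectorFun β D a) w := by
  intro hc
  apply hreg
  have hφw : φ w = 1 - a / 4 := (sectorFun_eq_half_iff β D ha hDf hβ₂ hβ₃).1 hw
  -- `sectorFun = g ∘ φ` with `g s = β ((1 - s) * (2 / a))`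
  set g : ℝ → ℝ := fun s => β ((1 - s) * (2 / a)) with hg
  have heq : sectorFun β D a = g ∘ φ := by
    funext w'; simp only [sectorFun, hg, comp_apply, hDf]
  rw [heq] at hc
  obtain ⟨d, hd, hder⟩ := hβ₄
  have hinner : HasDerivAt (fun s : ℝ => (1 - s) * (2 / a)) (-(2 / a)) (φ w) := by
    have := ((hasDerivAt_id (φ w)).const_sub 1).mul_const (2 / a)
    simpa using this
  have hgd : HasDerivAt g (d * -(2 / a)) (φ w) :=
    hder.comp_of_eq (φ w) hinner (by rw [hφw]; field_simp; ring)
  exact isMCriticalPt_of_comp (hφs.mdifferentiableAt (by simp)) hgd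
    (mul_ne_zero hd (neg_ne_zero.2 (div_ne_zero two_ne_zero ha.ne'))) hc

end SectorFun

/-! ## 4. The registered helper stub -/

/-- **Level data of a sector** (registered helper stub of `stub_sectorCores`): for a profile `β`
with `β ≡ 0` below `1/4`, `β ≤ 1/2 ↔ · ≤ 1/2`, `1/2 ≤ β ↔ 1/2 ≤ ·`, `β' (1/2) ≠ 0`, `β` smooth, and
a compact `4`-manifold with boundary `W` with a Morse function `φ` adapted to `∂W`: a collar `c` of
a boundary datum `b`, a smooth `F : W → ℝ` and `a > 0` with `F (c (x, t)) = β t`, `F = 0` on `∂W`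
and on `{φ > 1 - a/8}`, `F ≥ 1/2 ↔ φ ≤ 1 - a/4`, `F` regular along `{F = 1/2}`, `φ` regular on
`{φ ≥ 1 - a/4}`, and `{F ≤ 1/2} ⊆ c(∂W × [0, 1/2])`.  (A statement PROVED in this file —
`stub_sectorLevelData` —, not a named fact.) -/
def SectorLevelData : Prop :=
  ∀ (β : ℝ → ℝ), (∀ s : ℝ, s ≤ 1 / 4 → β s = 0) → (∀ s : ℝ, β s ≤ 1 / 2 ↔ s ≤ 1 / 2) →
    (∀ s : ℝ, 1 / 2 ≤ β s ↔ 1 / 2 ≤ s) → (∃ d : ℝ, d ≠ 0 ∧ HasDerivAt β d (1 / 2)) →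
    ContDiff ℝ ∞ β →
  ∀ (W : Type) [TopologicalSpace W] [T2Space W] [CompactSpace W]
    [ChartedSpace (EuclideanHalfSpace 4) W] [IsManifold (𝓡∂ 4) ∞ W]
    (b : BoundaryData (𝓡∂ 4) W (𝓡 3)) [Nonempty b.carrier] (φ : W → ℝ),
    IsMorseAdapted (𝓡∂ 4) φ →
    ∃ (c : b.Collar) (F : W → ℝ) (a : ℝ), 0 < a ∧ ContMDiff (𝓡∂ 4) 𝓘(ℝ, ℝ) ∞ F ∧
      (∀ (x : b.carrier) (t : Set.Icc (0 : ℝ) 1), F (c (x, t)) = β t) ∧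
      (∀ w, w ∈ (𝓡∂ 4).boundary W → F w = 0) ∧
      (∀ w, 1 - a / 8 < φ w → F w = 0) ∧
      (∀ w, 1 / 2 ≤ F w ↔ φ w ≤ 1 - a / 4) ∧
      (∀ w, F w = 1 / 2 → ¬ IsMCriticalPt (𝓡∂ 4) F w) ∧
      (∀ w, 1 - a / 4 ≤ φ w → ¬ IsMCriticalPt (𝓡∂ 4) φ w) ∧
      (∀ w, F w ≤ 1 / 2 → ∃ (x : b.carrier) (t : Set.Icc (0 : ℝ) 1), (t : ℝ) ≤ 1 / 2 ∧ c (x, t) = w)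

/-- **Registered helper stub `stub_sectorLevelData`** of line `lp-by-sphere-system-surgery`:
the flow-out collar adapted to `φ` (height `a ≤ δ`) and the sector level function
`sectorFun β D a`. [cite: MilnorHCobordism1965, proof of Thm. 3.4] -/
theorem stub_sectorLevelData : SectorLevelData := by
  intro β hβ₁ hβ₂ hβ₃ hβ₄ hβ₅ W _ _ _ _ _ b _ φ hφ
  obtain ⟨D, hDf, hDreg⟩ := exists_flowoutInput_of_isMorseAdapted (n := 2) hφ
  obtain ⟨Γ, hΓδ⟩ := exists_cover_a_le D (Classical.choice D.nonempty_cover)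
  have ha := Γ.a_pos
  have hregφ : ∀ w, 1 - Γ.a / 4 ≤ φ w → ¬ IsMCriticalPt (𝓡∂ 4) φ w := fun w hw =>
    hDreg w (by rw [hDf]; linarith)
  refine ⟨(Γ.openCollarData b).toCollar, sectorFun β D Γ.a, Γ.a, ha, contMDiff_sectorFun β D hβ₅ _,
    fun x t => ?_, fun w hw => sectorFun_eq_zero_of_mem_boundary β D hβ₁ _ hw,
    fun w hw => sectorFun_eq_zero_of_lt β D ha hDf hβ₁ hw,
    fun w => half_le_sectorFun_iff β D ha hDf hβ₃, fun w hw => ?_, hregφ, fun w hw => ?_⟩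
  · show β (D.f ((Γ.openCollarData b).toCollar (x, t)) * (2 / Γ.a)) = β t
    rw [← openCollarData_height b Γ, height_toCollar b Γ x t]
  · exact not_isMCriticalPt_sectorFun β D ha hDf hβ₂ hβ₃ hβ₄ hφ.1.1 hw
      (hregφ w ((sectorFun_eq_half_iff β D ha hDf hβ₂ hβ₃).1 hw).ge)
  · have hheight : (Γ.openCollarData b).height w ≤ 1 / 2 := (hβ₂ _).1 hw
    obtain ⟨x, t, ht, hxt⟩ := exists_toCollar_eq_of_height_le b Γ (hheight.trans (by norm_num))
    exact ⟨x, t, ht ▸ hheight, hxt⟩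

end Summit.SmoothPoincare4.SmoothPoincare4.Cruxes.AgkCor6Sufficiency.LpBySphereSystemSurgery

end
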